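import Mathlib
import HarnessLib.Audit
import Summits.PneNP.PneNP.Theorems.PstarNorCoreTools

/-!
# The accounting inequality (ACC) for an XOR-closed core with pendants (ROUND-24, memo `CORE-BOUND-NOTES.md` §10.2)

FRONTIER range-avoidance ladder, rung F-N3, ROUND 24 (cell `pnp-ideate`, planner memo `r24/CORE-BOUND-NOTES.md` §10.2 "one accounting inequality
behind all the deaths"; restricted-model proof complexity — nothing here bears on `P` versus `NP`).

Mechanism-free bookkeeping.  `J₀` is XOR-closed (`PstarCoreBound.XorClosed`), `R` a set of further outputs ("pendants": the gadget `g₀`, readers,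
…) disjoint from `J₀`, `𝓕 = J₀ ∪ R`, on an `(r, 3/2)`-boundary-expanding instance with `#𝓕 ≤ r`.  The XOR slots of `J₀` carry no boundary variable
of `𝓕` (`PstarNorDataCounts.xor_not_mem_bdry` / `xor_not_mem_bdry_sup` below), so

* `card_bdry_union_le` — `#bdry 𝓕 ≤ Σ_{g ∈ R} #(varSet g ∩ bdry 𝓕) + #{AND slots of J₀ private in 𝓕}`;
* `acc`               — **(ACC), general form**: with `D₀ := #{AND slots of J₀ whose variable is NOT private in 𝓕}`,
                          `2·D₀ + 3·#R ≤ #J₀ + 2·Σ_{g ∈ R} #(varSet g ∩ bdry 𝓕)`;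
* `acc_of_shared_and` — **(ACC) of the memo**: if every pendant has both AND variables non-private in `𝓕` (each pendant then has at most its two
                          XOR tips private, `card_private_le_two_of_and_shared`), `2·D₀ ≤ #J₀ + #R`, i.e. `D₀ ≤ (#J₀ + #R)/2`.
  Tight for `CONS-T` (`3, {g₀}`, `D₀ = 2`), `CONS-P3` (`5, {g₀}`, `D₀ = 3`), the gate unit (`3, {reader}`, `D₀ = 2`) (memo §10.2).

The pendant-free case `R = ∅` is `PstarCoreSharing.two_mul_card_shared_le`.
-/

set_option linter.dupNamespace false -- `Summit.PneNP.PneNP.…`: summit = sub-problem name (D-0017 single-conjunct layout)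

open Finset Literature.Computability.Complexity
open Summit.PneNP.PneNP.Theorems.PstarSALevel (varSet bdry BoundaryExpanding)
open Summit.PneNP.PneNP.Theorems.PstarCentreFree (vars_mem_varSet)
open Summit.PneNP.PneNP.Theorems.PstarGapOneKills (exists_other_reader)
open Summit.PneNP.PneNP.Theorems.PstarNorCoreTools (not_mem_bdry_of_two card_bdry_le_sum card_varSet_inter_bdry_le)
open Summit.PneNP.PneNP.Theorems.PstarCoreBound (XorClosed)

namespace Summit.PneNP.PneNP.Theorems.PstarCoreAccounting

variable {n m : ℕ}

/-- There are exactly two AND slot positions. -/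
private theorem card_andPos : ((univ : Finset (Fin 4)).filter fun s => 2 ≤ s.val).card = 2 := by decide

/-- An XOR-slot variable of an XOR-closed `J₀` is a boundary variable of no family containing `J₀`. -/
theorem xor_not_mem_bdry_sup (I : LocalMap 4 n m) {J₀ X : Finset (Fin m)} (hx : XorClosed I J₀) (hX : J₀ ⊆ X) {f : Fin m} (hf : f ∈ J₀)
    (s : Fin 4) (hs : s.val < 2) : I.vars f s ∉ bdry I X := by
  obtain ⟨g, hg, hne, hv⟩ := exists_other_reader I hf (vars_mem_varSet I f s) (hx f hf s hs)
  exact not_mem_bdry_of_two I (hX hf) (hX hg) hne.symm (vars_mem_varSet I f s) hv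

/-- The private variables of an output of `J₀` in a family `X ⊇ J₀` come from its AND slots private in `X`. -/
theorem card_varSet_inter_bdry_le_slots (I : LocalMap 4 n m) {J₀ X : Finset (Fin m)} (hx : XorClosed I J₀) (hX : J₀ ⊆ X) {j : Fin m}
    (hj : j ∈ J₀) :
    (varSet I j ∩ bdry I X).card ≤ (((univ : Finset (Fin 4)).filter fun s => 2 ≤ s.val).filter fun s => I.vars j s ∈ bdry I X).card := by
  classical
  have hsub : varSet I j ∩ bdry I X ⊆
      ((((univ : Finset (Fin 4)).filter fun s => 2 ≤ s.val).filter fun s => I.vars j s ∈ bdry I X).image (I.vars j)) := by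
    intro v hv
    rw [mem_inter] at hv
    obtain ⟨hvj, hvb⟩ := hv
    unfold PstarSALevel.varSet at hvj
    obtain ⟨s, -, hs⟩ := mem_image.1 hvj
    have h2 : 2 ≤ s.val := by
      by_contra hlt
      exact xor_not_mem_bdry_sup I hx hX hj s (by omega) (hs ▸ hvb)
    exact mem_image.2 ⟨s, mem_filter.2 ⟨mem_filter.2 ⟨mem_univ _, h2⟩, hs ▸ hvb⟩, hs⟩
  exact le_trans (card_le_card hsub) card_image_le

/-- Private plus shared AND slots of `J₀` (relative to any family `X`) number `2·#J₀`. -/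
theorem sum_private_add_sum_shared (I : LocalMap 4 n m) (J₀ X : Finset (Fin m)) :
    ∑ j ∈ J₀, (((univ : Finset (Fin 4)).filter fun s => 2 ≤ s.val).filter fun s => I.vars j s ∈ bdry I X).card +
      ∑ j ∈ J₀, (((univ : Finset (Fin 4)).filter fun s => 2 ≤ s.val).filter fun s => I.vars j s ∉ bdry I X).card = 2 * J₀.card := by
  rw [← sum_add_distrib, sum_congr rfl fun j _ => card_filter_add_card_filter_not _, sum_const, card_andPos, smul_eq_mul, mul_comm]

/-- **Boundary of `J₀ ∪ R`**: pendants contribute their private variables, `J₀` only its AND slots private in the union. -/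
theorem card_bdry_union_le (I : LocalMap 4 n m) {J₀ R : Finset (Fin m)} (hx : XorClosed I J₀) (hdis : Disjoint J₀ R) :
    (bdry I (J₀ ∪ R)).card ≤ ∑ g ∈ R, (varSet I g ∩ bdry I (J₀ ∪ R)).card +
      ∑ j ∈ J₀, (((univ : Finset (Fin 4)).filter fun s => 2 ≤ s.val).filter fun s => I.vars j s ∈ bdry I (J₀ ∪ R)).card := by
  classical
  let q : Fin m → ℕ := fun j =>
    if j ∈ J₀ then (((univ : Finset (Fin 4)).filter fun s => 2 ≤ s.val).filter fun s => I.vars j s ∈ bdry I (J₀ ∪ R)).card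
    else (varSet I j ∩ bdry I (J₀ ∪ R)).card
  have hq : ∀ j ∈ J₀ ∪ R, (varSet I j ∩ bdry I (J₀ ∪ R)).card ≤ q j := by
    intro j _
    by_cases hjJ : j ∈ J₀
    · simp only [q, hjJ, if_true]
      exact card_varSet_inter_bdry_le_slots I hx subset_union_left hjJ
    · simp only [q, hjJ, if_false, le_refl]
  have h1 := card_bdry_le_sum I (J₀ ∪ R) q hq
  rw [sum_union hdis] at h1
  have hJ : ∑ j ∈ J₀, q j = ∑ j ∈ J₀, (((univ : Finset (Fin 4)).filter fun s => 2 ≤ s.val).filter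
      fun s => I.vars j s ∈ bdry I (J₀ ∪ R)).card := sum_congr rfl fun j hj => by simp only [q, hj, if_true]
  have hR : ∑ j ∈ R, q j = ∑ g ∈ R, (varSet I g ∩ bdry I (J₀ ∪ R)).card :=
    sum_congr rfl fun j hj => by simp only [q, disjoint_right.1 hdis hj, if_false]
  omega

/-- **(ACC), general form.**  `2·D₀ + 3·#R ≤ #J₀ + 2·Σ_{g ∈ R} #(private variables of g)`, `D₀` = number of AND slots of `J₀` whose variable
is not private in `J₀ ∪ R`. -/
theorem acc (I : LocalMap 4 n m) {r : ℕ} (hB : BoundaryExpanding r I) {J₀ R : Finset (Fin m)} (hx : XorClosed I J₀) (hdis : Disjoint J₀ R)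
    (hk : (J₀ ∪ R).card ≤ r) :
    2 * ∑ j ∈ J₀, (((univ : Finset (Fin 4)).filter fun s => 2 ≤ s.val).filter fun s => I.vars j s ∉ bdry I (J₀ ∪ R)).card + 3 * R.card ≤
      J₀.card + 2 * ∑ g ∈ R, (varSet I g ∩ bdry I (J₀ ∪ R)).card := by
  have h1 := hB (J₀ ∪ R) hk
  rw [card_union_of_disjoint hdis] at h1
  have h2 := card_bdry_union_le I hx hdis
  have h3 := sum_private_add_sum_shared I J₀ (J₀ ∪ R)
  omega

/-- A pendant whose two AND variables are not private has at most its two XOR tips private. -/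
theorem card_private_le_two_of_and_shared (I : LocalMap 4 n m) (X : Finset (Fin m)) {g : Fin m}
    (hg : ∀ s : Fin 4, 2 ≤ s.val → I.vars g s ∉ bdry I X) : (varSet I g ∩ bdry I X).card ≤ 2 := by
  have h := card_varSet_inter_bdry_le I X g ((univ : Finset (Fin 4)).filter fun s => 2 ≤ s.val)
    fun s hs => hg s (mem_filter.1 hs).2
  rw [card_andPos] at h
  exact h

/-- An AND variable of a pendant that also occurs in an output of `J₀` is not private in `J₀ ∪ R`. -/
theorem and_not_mem_bdry_of_mem (I : LocalMap 4 n m) {J₀ R : Finset (Fin m)} (hdis : Disjoint J₀ R) {g : Fin m} (hg : g ∈ R) (s : Fin 4)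
    {f : Fin m} (hf : f ∈ J₀) (hv : I.vars g s ∈ varSet I f) : I.vars g s ∉ bdry I (J₀ ∪ R) :=
  not_mem_bdry_of_two I (mem_union_right _ hg) (mem_union_left _ hf) (fun h => disjoint_left.1 hdis hf (h ▸ hg))
    (vars_mem_varSet I g s) hv

/-- **(ACC) of memo §10.2.**  If both AND variables of every pendant are non-private in `𝓕 = J₀ ∪ R` then `2·D₀ ≤ #J₀ + #R`. -/
theorem acc_of_shared_and (I : LocalMap 4 n m) {r : ℕ} (hB : BoundaryExpanding r I) {J₀ R : Finset (Fin m)} (hx : XorClosed I J₀)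
    (hdis : Disjoint J₀ R) (hk : (J₀ ∪ R).card ≤ r) (hR : ∀ g ∈ R, ∀ s : Fin 4, 2 ≤ s.val → I.vars g s ∉ bdry I (J₀ ∪ R)) :
    2 * ∑ j ∈ J₀, (((univ : Finset (Fin 4)).filter fun s => 2 ≤ s.val).filter fun s => I.vars j s ∉ bdry I (J₀ ∪ R)).card ≤
      J₀.card + R.card := by
  have h1 := acc I hB hx hdis hk
  have h2 : ∑ g ∈ R, (varSet I g ∩ bdry I (J₀ ∪ R)).card ≤ ∑ g ∈ R, 2 :=
    sum_le_sum fun g hg => card_private_le_two_of_and_shared I (J₀ ∪ R) (hR g hg)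
  rw [sum_const, smul_eq_mul] at h2
  omega

/-- **The core alone** (`R = ∅`): `2·D₀ ≤ #J₀` — at most `#J₀ / 2` shared AND slots (memo §12.1; the product-set form is
`PstarCoreSharing.two_mul_card_shared_le`). -/
theorem two_mul_sum_shared_le (I : LocalMap 4 n m) {r : ℕ} (hB : BoundaryExpanding r I) {J₀ : Finset (Fin m)} (hx : XorClosed I J₀)
    (hk : J₀.card ≤ r) :
    2 * ∑ j ∈ J₀, (((univ : Finset (Fin 4)).filter fun s => 2 ≤ s.val).filter fun s => I.vars j s ∉ bdry I J₀).card ≤ J₀.card := by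
  have h := acc_of_shared_and I hB hx (disjoint_empty_right J₀) (by rw [union_empty]; exact hk) (fun g hg => absurd hg (notMem_empty g))
  rw [union_empty, card_empty, add_zero] at h
  exact h

end Summit.PneNP.PneNP.Theorems.PstarCoreAccounting
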